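import Summits.Ventures.PercRepro.GenQHypAddTwoC

/-!
# PercRepro — C-025 at `(q + 2, q)`: «hyperplane + one point» at EVERY type is an identity on the trace
(night-4, gen 2)

For `G = τ ∪ {a}` with `ρ(τ) = q` and `a ∉ cl(τ)`, the rank-`(q + 1)` subsets of `G` are exactly the `B ∪ {a}` over
`B ∈ R_q(τ)` (`Rq_succ_eq_image_insert`), `a` is a coloop of every one of them and every coloop of `M|B` stays a coloop
of `M|(B ∪ {a})` — so `m(B ∪ {a}) = m(B) + 1` EXACTLY (`mTr_insert_eq_of_notMem_closure`, by the exchange property) —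
and `G ∖ (B ∪ {a}) = τ ∖ B`.  Hence the balance of `G` at level `q + 1` and ANY type `t` is an identity on `τ`:

**`Jq_hyp_add_one_eq`**:
`Jq M (τ ∪ {a}) (q + 1) t = Σ_{B ∈ R_q(τ)} ((q + 3 − t)/(2 + m(B)) − Φ(q + 3, q + 1)·dem_t(B))`,

the hard max-trace balance of the trace with the weights `1/(2 + m)` in place of `1/(1 + m)`.  At `(q, t) = (4, 4)`
this is the thinnest corner of the `(7, 5)` layer `t = 4` (sheet §15 / §17): `Jq M (H ∪ {a}) 5 4 =
Σ_{B ∈ R_4(H)} (3/(2 + m(B)) − (7/6)·dem_4(B))` (`Jq_five_four_hyp_add_one_eq`), a statement about the rank-`4` trace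
alone — it is NOT typed as a per-flat `Prop` of record (RULING (rc)(2)(a)); the identity only names the object.
Imports `GenQHypAddTwoC` (for `dem`, `Jq_eq_sum_dem`, `eRk_insert_sub`).
-/

namespace PercRepro.GenQ

open Finset ThmH SixFour

variable {α : Type*} [DecidableEq α] {M : Matroid α} [M.Finite]

section HypAddOneAll

variable {τ : Finset α} {a : α} {q t : ℕ}

/-- Every coloop of `M|B` stays a coloop of `M|(B ∪ {a})` when `a ∉ cl(τ)`, `B ⊆ τ` (exchange). -/
theorem coloopsOf_subset_coloopsOf_insert (hacl : a ∉ M.closure (τ : Set α)) {B : Finset α}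
    (hB : B ⊆ τ) (haB : a ∉ B) : coloopsOf M B ⊆ coloopsOf M (insert a B) := by
  intro c hc
  rw [mem_coloopsOf] at hc ⊢
  refine ⟨Finset.mem_insert_of_mem hc.1, fun hmem => ?_⟩
  have hca : c ≠ a := fun h => haB (h ▸ hc.1)
  rw [Finset.erase_insert_of_ne hca.symm, Finset.coe_insert] at hmem
  have hex := Matroid.closure_exchange (M := M) (e := c) (f := a) (X := ((B.erase c : Finset α) : Set α))
    ⟨hmem, hc.2⟩
  apply hacl
  have h1 : (insert c ((B.erase c : Finset α) : Set α)) = (B : Set α) := by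
    rw [← Finset.coe_insert, Finset.insert_erase hc.1]
  rw [h1] at hex
  exact M.closure_subset_closure (Finset.coe_subset.2 hB) hex.1

/-- `a` is a coloop of `M|(B ∪ {a})` when `a ∉ cl(τ)`, `B ⊆ τ`. -/
theorem mem_coloopsOf_insert (hacl : a ∉ M.closure (τ : Set α)) {B : Finset α} (hB : B ⊆ τ) (haB : a ∉ B) :
    a ∈ coloopsOf M (insert a B) := by
  rw [mem_coloopsOf]
  refine ⟨Finset.mem_insert_self _ _, fun h => hacl ?_⟩
  rw [Finset.erase_insert haB] at h
  exact M.closure_subset_closure (Finset.coe_subset.2 hB) h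

/-- **`m(B ∪ {a}) = m(B) + 1`** for `B ⊆ τ`, `a ∉ cl(τ)`. -/
theorem mTr_insert_eq_of_notMem_closure (hacl : a ∉ M.closure (τ : Set α)) {B : Finset α}
    (hB : B ⊆ τ) (haB : a ∉ B) : mTr M (insert a B) = mTr M B + 1 := by
  apply le_antisymm (mTr_insert_le B a)
  unfold mTr
  have hsub : insert a (coloopsOf M B) ⊆ coloopsOf M (insert a B) :=
    Finset.insert_subset (mem_coloopsOf_insert hacl hB haB) (coloopsOf_subset_coloopsOf_insert hacl hB haB)
  have hnot : a ∉ coloopsOf M B := fun h => haB (coloopsOf_subset B h)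
  rw [← Finset.card_insert_of_notMem hnot]
  exact Finset.card_le_card hsub

/-- The rank-`(q + 1)` subsets of `τ ∪ {a}` are the `B ∪ {a}` over `B ∈ R_q(τ)`. -/
theorem Rq_succ_eq_image_insert (ha : a ∈ gr M) (hacl : a ∉ M.closure (τ : Set α))
    (hrτ : M.eRk (τ : Set α) = (q : ℕ∞)) :
    Rq M (insert a τ) (q + 1) = (Rq M τ q).image (fun B => insert a B) := by
  ext B
  rw [mem_Rq, Finset.mem_image]
  constructor
  · rintro ⟨hBG, hrB⟩
    have haB : a ∈ B := by
      by_contra haB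
      have hBH : B ⊆ τ := by
        intro x hx
        rcases Finset.mem_insert.1 (hBG hx) with h | h
        · exact absurd (h ▸ hx) haB
        · exact h
      have h := M.eRk_mono (Finset.coe_subset.2 hBH)
      rw [hrB, hrτ] at h
      exact enat_succ_not_le q h
    refine ⟨B.erase a, ?_, Finset.insert_erase haB⟩
    rw [mem_Rq]
    have hsub : B.erase a ⊆ τ := by
      intro x hx
      rw [Finset.mem_erase] at hx
      rcases Finset.mem_insert.1 (hBG hx.2) with h | h
      · exact absurd h hx.1
      · exact h
    refine ⟨hsub, ?_⟩
    have h := eRk_insert_sub ha hacl hsub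
    rw [Finset.insert_erase haB, hrB] at h
    obtain ⟨k, hk, -⟩ := eRk_eq_nat M (B.erase a)
    rw [hk] at h ⊢
    have h' : q + 1 = k + 1 := by exact_mod_cast h
    congr 1
    omega
  · rintro ⟨B'', hB'', rfl⟩
    rw [mem_Rq] at hB''
    refine ⟨Finset.insert_subset_insert a hB''.1, ?_⟩
    rw [eRk_insert_sub ha hacl hB''.1, hB''.2]
    push_cast
    rfl

omit [M.Finite] in
/-- `(τ ∪ {a}) ∖ (B ∪ {a}) = τ ∖ B`. -/
theorem insert_sdiff_insert_eq (haτ : a ∉ τ) (B : Finset α) : (insert a τ) \ (insert a B) = τ \ B := by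
  ext x
  simp only [Finset.mem_sdiff, Finset.mem_insert]
  constructor
  · rintro ⟨h1 | h1, h2⟩
    · exact absurd (Or.inl h1) h2
    · exact ⟨h1, fun h => h2 (Or.inr h)⟩
  · rintro ⟨h1, h2⟩
    refine ⟨Or.inr h1, ?_⟩
    rintro (h | h)
    · exact haτ (h ▸ h1)
    · exact h2 h

/-- **«Hyperplane + one point» at every type is an identity on the trace.** -/
theorem Jq_hyp_add_one_eq (ha : a ∈ gr M) (haτ : a ∉ τ) (hacl : a ∉ M.closure (τ : Set α))
    (hrτ : M.eRk (τ : Set α) = (q : ℕ∞)) (t : ℕ) :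
    Jq M (insert a τ) (q + 1) t =
      ∑ B ∈ Rq M τ q, ((((q + 1 : ℕ) : ℚ) + 2 - t) * (1 / (2 + (mTr M B : ℚ))) -
        ((((q + 1 : ℕ) : ℚ) + 2) / (((q + 1 : ℕ) : ℚ) + 1)) * dem M τ t B) := by
  rw [Jq_eq_sum_dem, Rq_succ_eq_image_insert ha hacl hrτ,
    Finset.sum_image (fun B hB B' hB' h => insert_inj_of_subset haτ (mem_Rq.1 hB).1 (mem_Rq.1 hB').1 h)]
  apply Finset.sum_congr rfl
  intro B hB
  have hBτ := (mem_Rq.1 hB).1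
  have haB : a ∉ B := fun h => haτ (hBτ h)
  unfold dem wInf
  rw [insert_sdiff_insert_eq haτ B, mTr_insert_eq_of_notMem_closure hacl hBτ haB]
  push_cast
  ring

/-- **The thinnest corner of the `(7, 5)` layer `t = 4`**: for a rank-`4` set `H` and `a ∉ cl(H)`,
`Jq M (H ∪ {a}) 5 4 = Σ_{B ∈ R_4(H)} (3/(2 + m(B)) − (7/6)·dem_4(B))` — a statement about the rank-`4` trace alone. -/
theorem Jq_five_four_hyp_add_one_eq {H : Finset α} (ha : a ∈ gr M) (haH : a ∉ H) (hacl : a ∉ M.closure (H : Set α))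
    (hrH : M.eRk (H : Set α) = 4) :
    Jq M (insert a H) 5 4 = ∑ B ∈ Rq M H 4, (3 / (2 + (mTr M B : ℚ)) - (7 / 6) * dem M H 4 B) := by
  have h := Jq_hyp_add_one_eq (M := M) (q := 4) ha haH hacl (by rw [hrH]; rfl) 4
  rw [h]
  apply Finset.sum_congr rfl
  intro B _
  push_cast
  ring

end HypAddOneAll

end PercRepro.GenQ
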